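import Mathlib
import Literature.LinearAlgebra.Matrix.SpecialLinearReductionSurjective
import Summits.BirchSwinnertonDyer.BirchSwinnertonDyer.Theorems.KatoDescentTamePotSupersingularTameLowerFibreAdjointH1Five
import Summits.BirchSwinnertonDyer.BirchSwinnertonDyer.Theorems.KatoDescentTamePotSupersingularTameLowerFibreAdjointBricksFiveInflation

/-!
# Bricks for the `GL₂(𝔽₅)`-lifting route (T5′), IV: `H¹(S^μ(ℤ/5^m), 𝔰𝔩₂(𝔽₅)) = 0` for every level

Continuation of `…TameLowerFibreAdjointBricksFive{,Det,Inflation}` (same namespace). ARM-P audit r07 S7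
ADDENDUM-1 §C runs Manoharmayum's lifting theorem ([M] = Proc. AMS 143 (2015), arXiv:1304.1196) at the
excluded pair `(n, k) = (2, 𝔽₅)` with the finite group `Q = S^μ(W_m) = {g ∈ GL₂(ℤ/5^m) : det g ∈ μ₄}` in
place of `SL₂(W_m)`; its step (C3)(d) — «THE NEW INPUT» — is the vanishing
`H¹(S^μ(ℤ/5^m), 𝔰𝔩₂(𝔽₅)) = 0` for EVERY `m ≥ 1` (adjoint action through reduction mod `5`). On paper
(C3)(d) is obtained from `H¹(GL₂(𝔽₅), 𝔰𝔩₂) = 0` (p532773, in print [AdRB] Rem. 3.42 ← Flach 1992) by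
inflation–restriction along `SL₂(W_m) ◁ Q` and [M] Prop. 3.6, at the price of ONE sign: `diag(ζ₄, 1)`
acts by `−1` on the line `H¹(SL₂(𝔽₅), 𝔰𝔩₂(𝔽₅))` — machine-checked by the reader, but neither a kernel
theorem nor located in print beyond `m = 1` (r07 S7 ADDENDUM-4, 2026-08-27).

This file proves (C3)(d) for every level DIRECTLY, with no sign and no line:
`smu_exists_traceless_eq_coboundary` — for every `m ≥ 0`, every `𝔰𝔩₂(𝔽₅)`-valued 1-cocycle on
`S^μ(ℤ/5^{m+1})` is the coboundary of a trace-zero matrix. Induction on `m`: `m = 0` is p532773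
(`S^μ(𝔽₅) = GL₂(𝔽₅)`), transported along `ℤ/5^1 ≅ ℤ/5`; for the step, the kernel of
`S^μ(ℤ/5^{m+2}) → S^μ(ℤ/5^{m+1})` lies in `SL₂` (a determinant in `μ₄` that is `≡ 1 (mod 5)` is `1`,
`eq_one_of_pow_four_eq_one`, file II), so it is the kernel `K` of `SL₂(ℤ/5^{m+2}) → SL₂(ℤ/5^{m+1})`, on
which every cocycle vanishes by [M] Prop. 3.6 (`cocycle_eq_zero_of_map_eq_one`, file III); hence the
cocycle is constant on fibres and DESCENDS to `S^μ(ℤ/5^{m+1})` (the reduction `S^μ → S^μ` is onto: lift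
the `SL₂` part by Andrianov–Zhuravlev, tree theorem
`Literature.LinearAlgebra.Matrix.IntegerSpecialLinear.exists_specialLinearGroup_map_intCast_eq`, and the
determinant `δ ∈ μ₄` by `D₀ ↦ D₀⁵`), where the induction hypothesis applies. Also recorded:
`det_eq_one_of_det_pow_four_of_map_eq_one` ((C0): «a det in `μ₄` that is `≡ 1` is `1`») and
`smu_cocycle_eq_zero_of_map_eq_one` (cocycles on `S^μ` vanish on the kernel).

With files I–III and p532773 every `(2, 5, 𝔽₅)`-specific input of ADD-1 §C (C3) is now a kernel
theorem, INCLUDING (d) at all layers; [M]'s general group theory (Prop. 2.2, Cor. 3.13, Claim 4.3, the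
limit (h)) stays on paper. Route-free, no definitions (`S^μ` = the hypothesis `det ^ 4 = 1`), nothing
about elliptic curves or items 19618/19981 (open). Target T-S7r07-1 (`FibreLatticeInput 5`).
-/

set_option linter.dupNamespace false

open Matrix

namespace Summit.BirchSwinnertonDyer.BirchSwinnertonDyer.Theorems.GL2F5AdjointBricks

section smu

/-- **The kernel of `S^μ(ℤ/5^{m+1}) → S^μ(𝔽₅)`-type reductions lies in `SL₂`.** If
`g ∈ GL₂(ℤ/5^{m+1})` has `det g ∈ μ₄` (`(det g)⁴ = 1`) and reduces to `1` modulo `5`, then `det g = 1`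
(Teichmüller rigidity `eq_one_of_pow_four_eq_one`). In particular the kernel of
`S^μ(ℤ/5^{m+1}) → S^μ(ℤ/5^m)` (`m ≥ 1`) is the kernel of `SL₂(ℤ/5^{m+1}) → SL₂(ℤ/5^m)`
(ARM-P r07 S7 ADD-1 §C (C0): «a det in `μ₄` that is `≡ 1` is `1`»). -/
theorem det_eq_one_of_det_pow_four_of_map_eq_one (m : ℕ) (g : GL (Fin 2) (ZMod (5 ^ (m + 1))))
    (hμ : Matrix.det (g : Matrix (Fin 2) (Fin 2) (ZMod (5 ^ (m + 1)))) ^ 4 = 1)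
    (hg : Matrix.GeneralLinearGroup.map (ZMod.castHom (dvd_pow_self 5 (Nat.succ_ne_zero m)) (ZMod 5)) g = 1) :
    Matrix.det (g : Matrix (Fin 2) (Fin 2) (ZMod (5 ^ (m + 1)))) = 1 := by
  apply eq_one_of_pow_four_eq_one m _ _ hμ
  have h := congrArg (fun x : GL (Fin 2) (ZMod 5) => Matrix.det (x : Matrix (Fin 2) (Fin 2) (ZMod 5))) hg
  rw [Units.val_one, Matrix.det_one] at h
  rw [← h, RingHom.map_det]
  congr 1

/-- **Cocycles on `S^μ(ℤ/5^{m+1})` vanish on the kernel of reduction to level `m` (`m ≥ 1`).** Let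
`f` be an `𝔰𝔩₂(𝔽₅)`-valued 1-cocycle on `S^μ(ℤ/5^{m+1}) = {g ∈ GL₂(ℤ/5^{m+1}) : (det g)⁴ = 1}` for the
adjoint action through reduction mod `5` (values and identity asked only on `S^μ`). Then `f k = 0` for
every `k ∈ S^μ` reducing to `1` in `GL₂(ℤ/5^m)`: such a `k` lies in `SL₂` by
`det_eq_one_of_det_pow_four_of_map_eq_one`, and `f ∘ (SL₂ ↪ GL₂)` is a cocycle on `SL₂(ℤ/5^{m+1})`, which
vanishes on `ker(SL₂(ℤ/5^{m+1}) → SL₂(ℤ/5^m))` by [M] Prop. 3.6 (`cocycle_eq_zero_of_map_eq_one`). -/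
theorem smu_cocycle_eq_zero_of_map_eq_one (m : ℕ) (hm : 1 ≤ m)
    (f : GL (Fin 2) (ZMod (5 ^ (m + 1))) → Matrix (Fin 2) (Fin 2) (ZMod 5))
    (htr : ∀ g : GL (Fin 2) (ZMod (5 ^ (m + 1))),
      Matrix.det (g : Matrix (Fin 2) (Fin 2) (ZMod (5 ^ (m + 1)))) ^ 4 = 1 → Matrix.trace (f g) = 0)
    (hf : ∀ g h : GL (Fin 2) (ZMod (5 ^ (m + 1))),
      Matrix.det (g : Matrix (Fin 2) (Fin 2) (ZMod (5 ^ (m + 1)))) ^ 4 = 1 →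
      Matrix.det (h : Matrix (Fin 2) (Fin 2) (ZMod (5 ^ (m + 1)))) ^ 4 = 1 →
        f (g * h) = f g +
          (Matrix.GeneralLinearGroup.map (ZMod.castHom (dvd_pow_self 5 (Nat.succ_ne_zero m)) (ZMod 5)) g).val *
            f h *
          ((Matrix.GeneralLinearGroup.map (ZMod.castHom (dvd_pow_self 5 (Nat.succ_ne_zero m)) (ZMod 5)) g)⁻¹).val)
    (k : GL (Fin 2) (ZMod (5 ^ (m + 1))))
    (hkμ : Matrix.det (k : Matrix (Fin 2) (Fin 2) (ZMod (5 ^ (m + 1)))) ^ 4 = 1)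
    (hk : Matrix.GeneralLinearGroup.map (ZMod.castHom (pow_dvd_pow 5 m.le_succ) (ZMod (5 ^ m))) k = 1) :
    f k = 0 := by
  haveI : NeZero (5 ^ (m + 1)) := ⟨pow_ne_zero _ (by norm_num)⟩
  haveI : NeZero (5 ^ m) := ⟨pow_ne_zero _ (by norm_num)⟩
  set c5 := ZMod.castHom (dvd_pow_self 5 (Nat.succ_ne_zero m)) (ZMod 5) with hc5
  set cm := ZMod.castHom (pow_dvd_pow 5 m.le_succ) (ZMod (5 ^ m)) with hcm
  set ρ := Matrix.GeneralLinearGroup.map (n := Fin 2) c5 with hρ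
  set red := Matrix.GeneralLinearGroup.map (n := Fin 2) cm with hred
  -- `k` reduces to `1` mod `5` as well
  have hm0 : m ≠ 0 := by omega
  set c5' := ZMod.castHom (dvd_pow_self 5 hm0) (ZMod 5) with hc5'
  have hcomp : c5'.comp cm = c5 := Subsingleton.elim _ _
  have hk5 : ρ k = 1 := by
    have h : Matrix.GeneralLinearGroup.map (n := Fin 2) (c5'.comp cm) k = ρ k := by rw [hcomp]
    rw [← h, Matrix.GeneralLinearGroup.map_comp]
    show Matrix.GeneralLinearGroup.map c5' (red k) = 1
    rw [hk, map_one]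
  -- so `det k = 1` and `k` comes from `SL₂`
  have hdet : Matrix.det (k : Matrix (Fin 2) (Fin 2) (ZMod (5 ^ (m + 1)))) = 1 :=
    det_eq_one_of_det_pow_four_of_map_eq_one m k hkμ hk5
  set k' : Matrix.SpecialLinearGroup (Fin 2) (ZMod (5 ^ (m + 1))) := ⟨k.val, hdet⟩ with hk'
  have hkk' : Matrix.SpecialLinearGroup.toGL k' = k := Units.ext rfl
  -- the restricted cocycle on `SL₂(ℤ/5^{m+1})`
  set ρS := Matrix.SpecialLinearGroup.map (n := Fin 2) c5 with hρS
  set redS := Matrix.SpecialLinearGroup.map (n := Fin 2) cm with hredS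
  let fS : Matrix.SpecialLinearGroup (Fin 2) (ZMod (5 ^ (m + 1))) → Matrix (Fin 2) (Fin 2) (ZMod 5) :=
    fun s => f (Matrix.SpecialLinearGroup.toGL s)
  have hSμ : ∀ s : Matrix.SpecialLinearGroup (Fin 2) (ZMod (5 ^ (m + 1))),
      Matrix.det ((Matrix.SpecialLinearGroup.toGL s : GL (Fin 2) (ZMod (5 ^ (m + 1)))) :
        Matrix (Fin 2) (Fin 2) (ZMod (5 ^ (m + 1)))) ^ 4 = 1 := by
    intro s
    rw [Matrix.SpecialLinearGroup.coe_GL_coe_matrix, s.prop, one_pow]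
  have hρval : ∀ s : Matrix.SpecialLinearGroup (Fin 2) (ZMod (5 ^ (m + 1))),
      (ρ (Matrix.SpecialLinearGroup.toGL s)).val = ((ρS s : Matrix.SpecialLinearGroup (Fin 2) (ZMod 5)) :
        Matrix (Fin 2) (Fin 2) (ZMod 5)) := by
    intro s
    ext i j
    rfl
  have hρinv : ∀ s : Matrix.SpecialLinearGroup (Fin 2) (ZMod (5 ^ (m + 1))),
      ((ρ (Matrix.SpecialLinearGroup.toGL s))⁻¹).val = (((ρS s)⁻¹ : Matrix.SpecialLinearGroup (Fin 2) (ZMod 5)) :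
        Matrix (Fin 2) (Fin 2) (ZMod 5)) := by
    intro s
    rw [← map_inv, ← map_inv, ← map_inv]
    exact hρval s⁻¹
  have hfS_tr : ∀ s, Matrix.trace (fS s) = 0 := fun s => htr _ (hSμ s)
  have hfS : ∀ s t, fS (s * t) = fS s +
      ((ρS s : Matrix.SpecialLinearGroup (Fin 2) (ZMod 5)) : Matrix (Fin 2) (Fin 2) (ZMod 5)) * fS t *
      (((ρS s)⁻¹ : Matrix.SpecialLinearGroup (Fin 2) (ZMod 5)) : Matrix (Fin 2) (Fin 2) (ZMod 5)) := by
    intro s t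
    show f (Matrix.SpecialLinearGroup.toGL (s * t)) = _
    rw [map_mul, hf _ _ (hSμ s) (hSμ t), hρval, hρinv]
  have hk'red : redS k' = 1 := by
    apply Subtype.ext
    have h := congrArg (fun x : GL (Fin 2) (ZMod (5 ^ m)) => (x : Matrix (Fin 2) (Fin 2) (ZMod (5 ^ m)))) hk
    simp only [Units.val_one] at h
    rw [Matrix.SpecialLinearGroup.coe_one, ← h]
    ext i j
    rfl
  have h0 : fS k' = 0 := cocycle_eq_zero_of_map_eq_one m hm fS hfS_tr hfS k' hk'red
  simpa only [fS, hkk'] using h0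

/-- **ARM-P r07 S7 ADD-1 §C (C3)(d) for EVERY layer: `H¹(S^μ(ℤ/5^{m+1}), 𝔰𝔩₂(𝔽₅)) = 0` (`m ≥ 0`).**
Let `f : GL₂(ℤ/5^{m+1}) → M₂(𝔽₅)` be trace-zero-valued and satisfy the cocycle identity
`f(gh) = f(g) + ḡ f(h) ḡ⁻¹` ON `S^μ = {(det)⁴ = 1}` (`ḡ` = reduction mod `5`). Then there is a trace-zero
`x ∈ M₂(𝔽₅)` with `f(g) = ḡ x ḡ⁻¹ − x` for every `g ∈ S^μ`. For `m = 0` this is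
`H¹(GL₂(𝔽₅), 𝔰𝔩₂(𝔽₅)) = 0` (`GL2F5AdjointH1.exists_traceless_eq_coboundary`, p532773; `S^μ(𝔽₅) = GL₂(𝔽₅)`);
the induction step descends `f` along the surjection `S^μ(ℤ/5^{m+2}) → S^μ(ℤ/5^{m+1})`, on whose kernel
`f` vanishes (`smu_cocycle_eq_zero_of_map_eq_one`). No use of the torus sign on `H¹(SL₂(𝔽₅), 𝔰𝔩₂)`. -/
theorem smu_exists_traceless_eq_coboundary (m : ℕ)
    (f : GL (Fin 2) (ZMod (5 ^ (m + 1))) → Matrix (Fin 2) (Fin 2) (ZMod 5))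
    (htr : ∀ g : GL (Fin 2) (ZMod (5 ^ (m + 1))),
      Matrix.det (g : Matrix (Fin 2) (Fin 2) (ZMod (5 ^ (m + 1)))) ^ 4 = 1 → Matrix.trace (f g) = 0)
    (hf : ∀ g h : GL (Fin 2) (ZMod (5 ^ (m + 1))),
      Matrix.det (g : Matrix (Fin 2) (Fin 2) (ZMod (5 ^ (m + 1)))) ^ 4 = 1 →
      Matrix.det (h : Matrix (Fin 2) (Fin 2) (ZMod (5 ^ (m + 1)))) ^ 4 = 1 →
        f (g * h) = f g +
          (Matrix.GeneralLinearGroup.map (ZMod.castHom (dvd_pow_self 5 (Nat.succ_ne_zero m)) (ZMod 5)) g).val *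
            f h *
          ((Matrix.GeneralLinearGroup.map (ZMod.castHom (dvd_pow_self 5 (Nat.succ_ne_zero m)) (ZMod 5)) g)⁻¹).val) :
    ∃ x : Matrix (Fin 2) (Fin 2) (ZMod 5), Matrix.trace x = 0 ∧
      ∀ g : GL (Fin 2) (ZMod (5 ^ (m + 1))),
        Matrix.det (g : Matrix (Fin 2) (Fin 2) (ZMod (5 ^ (m + 1)))) ^ 4 = 1 →
          f g = (Matrix.GeneralLinearGroup.map (ZMod.castHom (dvd_pow_self 5 (Nat.succ_ne_zero m)) (ZMod 5)) g).val *
              x *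
            ((Matrix.GeneralLinearGroup.map (ZMod.castHom (dvd_pow_self 5 (Nat.succ_ne_zero m)) (ZMod 5)) g)⁻¹).val -
            x := by
  induction m with
  | zero =>
    -- level `5^1`: transport to `GL₂(ℤ/5)` and use `H¹(GL₂(𝔽₅), 𝔰𝔩₂) = 0`
    haveI : Fact (Nat.Prime 5) := ⟨by norm_num⟩
    haveI : NeZero (5 ^ (0 + 1)) := ⟨by norm_num⟩
    set c5 := ZMod.castHom (dvd_pow_self 5 (Nat.succ_ne_zero 0)) (ZMod 5) with hc5
    set ρ := Matrix.GeneralLinearGroup.map (n := Fin 2) c5 with hρ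
    have h51 : 5 ^ (0 + 1) ∣ 5 := by norm_num
    set e := ZMod.castHom h51 (ZMod (5 ^ (0 + 1))) with he
    set σ := Matrix.GeneralLinearGroup.map (n := Fin 2) e with hσ
    have hce : c5.comp e = RingHom.id _ := Subsingleton.elim _ _
    have hec : e.comp c5 = RingHom.id _ := Subsingleton.elim _ _
    have hρσ : ∀ g, ρ (σ g) = g := by
      intro g
      have h : Matrix.GeneralLinearGroup.map (n := Fin 2) (c5.comp e) g = g := by
        rw [hce, Matrix.GeneralLinearGroup.map_id]; rfl
      rw [Matrix.GeneralLinearGroup.map_comp] at h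
      exact h
    have hσρ : ∀ g, σ (ρ g) = g := by
      intro g
      have h : Matrix.GeneralLinearGroup.map (n := Fin 2) (e.comp c5) g = g := by
        rw [hec, Matrix.GeneralLinearGroup.map_id]; rfl
      rw [Matrix.GeneralLinearGroup.map_comp] at h
      exact h
    -- every element of `GL₂(𝔽₅)` has `det⁴ = 1`
    have hμ : ∀ g : GL (Fin 2) (ZMod 5),
        Matrix.det ((σ g : GL (Fin 2) (ZMod (5 ^ (0 + 1)))) : Matrix (Fin 2) (Fin 2) (ZMod (5 ^ (0 + 1)))) ^ 4 = 1 := by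
      intro g
      have hd : Matrix.det ((σ g : GL (Fin 2) (ZMod (5 ^ (0 + 1)))) : Matrix (Fin 2) (Fin 2) (ZMod (5 ^ (0 + 1)))) =
          e (Matrix.det (g : Matrix (Fin 2) (Fin 2) (ZMod 5))) := by
        rw [RingHom.map_det]
        congr 1
      have hne : Matrix.det (g : Matrix (Fin 2) (Fin 2) (ZMod 5)) ≠ 0 := by
        have h := (Matrix.GeneralLinearGroup.det g).ne_zero
        rwa [Matrix.GeneralLinearGroup.val_det_apply] at h
      have h4 : Matrix.det (g : Matrix (Fin 2) (Fin 2) (ZMod 5)) ^ 4 = 1 := by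
        have := ZMod.pow_card_sub_one_eq_one hne
        simpa using this
      rw [hd, ← map_pow, h4, map_one]
    let f' : GL (Fin 2) (ZMod 5) → Matrix (Fin 2) (Fin 2) (ZMod 5) := fun g => f (σ g)
    have hf' : ∀ g h : GL (Fin 2) (ZMod 5), f' (g * h) = f' g + g.val * f' h * (g⁻¹).val := by
      intro g h
      show f (σ (g * h)) = f (σ g) + _
      rw [map_mul, hf _ _ (hμ g) (hμ h), hρσ]
    have htr' : ∀ g, Matrix.trace (f' g) = 0 := fun g => htr _ (hμ g)
    obtain ⟨x, hx, hfx⟩ := GL2F5AdjointH1.exists_traceless_eq_coboundary f' hf' htr'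
    refine ⟨x, hx, fun g _ => ?_⟩
    have h := hfx (ρ g)
    simp only [f', hσρ] at h
    exact h
  | succ m ih =>
    haveI : Fact (Nat.Prime 5) := ⟨by norm_num⟩
    haveI : NeZero (5 ^ (m + 1 + 1)) := ⟨pow_ne_zero _ (by norm_num)⟩
    haveI : NeZero (5 ^ (m + 1)) := ⟨pow_ne_zero _ (by norm_num)⟩
    -- notation: `c5 : ℤ/5^{m+2} → 𝔽₅`, `cm : ℤ/5^{m+2} → ℤ/5^{m+1}`, `c5' : ℤ/5^{m+1} → 𝔽₅`
    set c5 := ZMod.castHom (dvd_pow_self 5 (Nat.succ_ne_zero (m + 1))) (ZMod 5) with hc5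
    set cm := ZMod.castHom (pow_dvd_pow 5 (m + 1).le_succ) (ZMod (5 ^ (m + 1))) with hcm
    set c5' := ZMod.castHom (dvd_pow_self 5 (Nat.succ_ne_zero m)) (ZMod 5) with hc5'
    set ρ := Matrix.GeneralLinearGroup.map (n := Fin 2) c5 with hρ
    set red := Matrix.GeneralLinearGroup.map (n := Fin 2) cm with hred
    set ρ' := Matrix.GeneralLinearGroup.map (n := Fin 2) c5' with hρ'
    have hcomp : c5'.comp cm = c5 := Subsingleton.elim _ _
    have hρred : ∀ g, ρ' (red g) = ρ g := by
      intro g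
      have h : Matrix.GeneralLinearGroup.map (n := Fin 2) (c5'.comp cm) g = ρ g := by rw [hcomp]
      rw [Matrix.GeneralLinearGroup.map_comp] at h
      exact h
    -- arithmetic of `π = 5^{m+1}` in `ℤ/5^{m+2}`
    set π : ZMod (5 ^ (m + 1 + 1)) := (5 : ZMod (5 ^ (m + 1 + 1))) ^ (m + 1) with hπ_def
    have h0 : (5 : ZMod (5 ^ (m + 1 + 1))) ^ (m + 1 + 1) = 0 := by
      exact_mod_cast ZMod.natCast_self (5 ^ (m + 1 + 1))
    have hπ2 : π * π = 0 := by
      rw [hπ_def, ← pow_add]; exact pow_eq_zero_of_le (by omega) h0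
    have h5π : 5 * π = 0 := by rw [hπ_def, ← pow_succ', h0]
    have hπcast : ((5 ^ (m + 1) : ℕ) : ZMod (5 ^ (m + 1 + 1))) = π := by rw [hπ_def]; push_cast; rfl
    -- determinants: `det (red g) = cm (det g)`, so `S^μ` maps to `S^μ`
    have hdet_red : ∀ g : GL (Fin 2) (ZMod (5 ^ (m + 1 + 1))),
        Matrix.det ((red g : GL (Fin 2) (ZMod (5 ^ (m + 1)))) : Matrix (Fin 2) (Fin 2) (ZMod (5 ^ (m + 1)))) =
          cm (Matrix.det (g : Matrix (Fin 2) (Fin 2) (ZMod (5 ^ (m + 1 + 1))))) := by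
      intro g
      rw [RingHom.map_det]
      congr 1
    have hμ_red : ∀ g : GL (Fin 2) (ZMod (5 ^ (m + 1 + 1))),
        Matrix.det (g : Matrix (Fin 2) (Fin 2) (ZMod (5 ^ (m + 1 + 1)))) ^ 4 = 1 →
        Matrix.det ((red g : GL (Fin 2) (ZMod (5 ^ (m + 1)))) : Matrix (Fin 2) (Fin 2) (ZMod (5 ^ (m + 1)))) ^ 4 = 1 := by
      intro g hg
      rw [hdet_red, ← map_pow, hg, map_one]
    have hμ_mul : ∀ g h : GL (Fin 2) (ZMod (5 ^ (m + 1 + 1))),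
        Matrix.det (g : Matrix (Fin 2) (Fin 2) (ZMod (5 ^ (m + 1 + 1)))) ^ 4 = 1 →
        Matrix.det (h : Matrix (Fin 2) (Fin 2) (ZMod (5 ^ (m + 1 + 1)))) ^ 4 = 1 →
        Matrix.det ((g * h : GL (Fin 2) (ZMod (5 ^ (m + 1 + 1)))) : Matrix (Fin 2) (Fin 2) (ZMod (5 ^ (m + 1 + 1)))) ^ 4 = 1 := by
      intro g h hg hh
      rw [Units.val_mul, Matrix.det_mul, mul_pow, hg, hh, one_mul]
    have hμ_inv : ∀ g : GL (Fin 2) (ZMod (5 ^ (m + 1 + 1))),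
        Matrix.det (g : Matrix (Fin 2) (Fin 2) (ZMod (5 ^ (m + 1 + 1)))) ^ 4 = 1 →
        Matrix.det ((g⁻¹ : GL (Fin 2) (ZMod (5 ^ (m + 1 + 1)))) : Matrix (Fin 2) (Fin 2) (ZMod (5 ^ (m + 1 + 1)))) ^ 4 = 1 := by
      intro g hg
      have h1 : Matrix.det (g : Matrix (Fin 2) (Fin 2) (ZMod (5 ^ (m + 1 + 1)))) *
          Matrix.det ((g⁻¹ : GL (Fin 2) (ZMod (5 ^ (m + 1 + 1)))) : Matrix (Fin 2) (Fin 2) (ZMod (5 ^ (m + 1 + 1)))) = 1 := by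
        rw [← Matrix.det_mul, ← Units.val_mul, mul_inv_cancel, Units.val_one, Matrix.det_one]
      have h2 := congrArg (· ^ 4) h1
      simp only [mul_pow, hg, one_mul, one_pow] at h2
      exact h2
    -- (1) `f` is constant on the fibres of `red` inside `S^μ`
    have hfibre : ∀ a b : GL (Fin 2) (ZMod (5 ^ (m + 1 + 1))),
        Matrix.det (a : Matrix (Fin 2) (Fin 2) (ZMod (5 ^ (m + 1 + 1)))) ^ 4 = 1 →
        Matrix.det (b : Matrix (Fin 2) (Fin 2) (ZMod (5 ^ (m + 1 + 1)))) ^ 4 = 1 →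
        red a = red b → f a = f b := by
      intro a b ha hb hab
      have hkμ := hμ_mul _ _ (hμ_inv _ ha) hb
      have hk : red (a⁻¹ * b) = 1 := by rw [map_mul, map_inv, hab, inv_mul_cancel]
      have h0 : f (a⁻¹ * b) = 0 := smu_cocycle_eq_zero_of_map_eq_one (m + 1) (by omega) f htr hf _ hkμ hk
      have h := hf a (a⁻¹ * b) ha hkμ
      rw [mul_inv_cancel_left, h0, Matrix.mul_zero, Matrix.zero_mul, add_zero] at h
      exact h.symm
    -- (2) `red : S^μ(ℤ/5^{m+2}) → S^μ(ℤ/5^{m+1})` is onto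
    have hlift : ∀ a : GL (Fin 2) (ZMod (5 ^ (m + 1))), ∃ A : GL (Fin 2) (ZMod (5 ^ (m + 1 + 1))),
        Matrix.det (a : Matrix (Fin 2) (Fin 2) (ZMod (5 ^ (m + 1)))) ^ 4 = 1 →
          red A = a ∧ Matrix.det (A : Matrix (Fin 2) (Fin 2) (ZMod (5 ^ (m + 1 + 1)))) ^ 4 = 1 := by
      intro a
      by_cases ha : Matrix.det (a : Matrix (Fin 2) (Fin 2) (ZMod (5 ^ (m + 1)))) ^ 4 = 1
      swap
      · exact ⟨1, fun h => absurd h ha⟩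
      -- the determinant `δ ∈ μ₄(ℤ/5^{m+1})` and the `SL₂` part `s₁ = diag(δ⁻¹, 1) a`
      set u : (ZMod (5 ^ (m + 1)))ˣ := Matrix.GeneralLinearGroup.det a with hu
      have hu_val : (u : ZMod (5 ^ (m + 1))) = Matrix.det (a : Matrix (Fin 2) (Fin 2) (ZMod (5 ^ (m + 1)))) := by
        rw [hu, Matrix.GeneralLinearGroup.val_det_apply]
      have hu4 : (u : ZMod (5 ^ (m + 1))) ^ 4 = 1 := by rw [hu_val, ha]
      have hu5 : (u : ZMod (5 ^ (m + 1))) ^ 5 = u := by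
        rw [pow_succ (u : ZMod (5 ^ (m + 1))) 4, hu4, one_mul]
      have hs₁det : Matrix.det (!![((u⁻¹ : (ZMod (5 ^ (m + 1)))ˣ) : ZMod (5 ^ (m + 1))), 0; 0, 1] *
          (a : Matrix (Fin 2) (Fin 2) (ZMod (5 ^ (m + 1))))) = 1 := by
        rw [Matrix.det_mul, Matrix.det_fin_two_of, ← hu_val, mul_one, mul_zero, sub_zero, Units.inv_mul]
      set s₁ : Matrix.SpecialLinearGroup (Fin 2) (ZMod (5 ^ (m + 1))) :=
        ⟨!![((u⁻¹ : (ZMod (5 ^ (m + 1)))ˣ) : ZMod (5 ^ (m + 1))), 0; 0, 1] *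
          (a : Matrix (Fin 2) (Fin 2) (ZMod (5 ^ (m + 1)))), hs₁det⟩ with hs₁
      -- lift the `SL₂` part (Andrianov–Zhuravlev via `SL₂(ℤ)`)
      obtain ⟨S, hS⟩ : ∃ S : Matrix.SpecialLinearGroup (Fin 2) (ZMod (5 ^ (m + 1 + 1))),
          Matrix.SpecialLinearGroup.map cm S = s₁ := by
        obtain ⟨V, hV⟩ :=
          Literature.LinearAlgebra.Matrix.IntegerSpecialLinear.exists_specialLinearGroup_map_intCast_eq (5 ^ (m + 1)) s₁
        refine ⟨Matrix.SpecialLinearGroup.map (Int.castRingHom (ZMod (5 ^ (m + 1 + 1)))) V, ?_⟩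
        rw [← hV]
        apply Subtype.ext
        ext i j
        simp only [hcm, Matrix.SpecialLinearGroup.map_apply_coe, RingHom.mapMatrix_apply, Matrix.map_apply,
          eq_intCast, map_intCast]
      have hSentry : ∀ i j, cm ((S : Matrix (Fin 2) (Fin 2) (ZMod (5 ^ (m + 1 + 1)))) i j) =
          (s₁ : Matrix (Fin 2) (Fin 2) (ZMod (5 ^ (m + 1)))) i j := by
        intro i j
        have h := congrArg (fun x : Matrix.SpecialLinearGroup (Fin 2) (ZMod (5 ^ (m + 1))) =>
          (x : Matrix (Fin 2) (Fin 2) (ZMod (5 ^ (m + 1)))) i j) hS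
        simpa only [Matrix.SpecialLinearGroup.map_apply_coe, RingHom.mapMatrix_apply, Matrix.map_apply] using h
      -- lift the determinant: `D = D₀⁵` with `D₀` any lift of `δ`
      set D₀ : ZMod (5 ^ (m + 1 + 1)) := (((u : ZMod (5 ^ (m + 1))).val : ℕ) : ZMod (5 ^ (m + 1 + 1))) with hD₀
      have hD₀ : cm D₀ = u := by
        rw [hD₀, map_natCast, ZMod.natCast_zmod_val]
      set D : ZMod (5 ^ (m + 1 + 1)) := D₀ ^ 5 with hD
      have hDred : cm D = u := by rw [hD, map_pow, hD₀, hu5]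
      have hD4 : D ^ 4 = 1 := by
        have hz : cm (D₀ ^ 4 - 1) = 0 := by rw [map_sub, map_pow, hD₀, hu4, map_one, sub_self]
        obtain ⟨t, ht⟩ := exists_eq_mul_of_castHom_eq_zero (m + 1) _ hz
        rw [hπcast, sub_eq_iff_eq_add] at ht
        have hD04 : D ^ 4 = (D₀ ^ 4) ^ 5 := by rw [hD]; ring
        rw [hD04, ht]
        linear_combination t * h5π + (10 * t ^ 2 + 10 * π * t ^ 3 + 5 * π ^ 2 * t ^ 4 + π ^ 3 * t ^ 5) * hπ2
      have hD13 : D * D ^ 3 = 1 := by rw [← pow_succ' D 3, hD4]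
      have hD31 : D ^ 3 * D = 1 := by rw [← pow_succ D 3, hD4]
      -- the torus lift `T = diag(D, 1)` and the lift `A = T · S`
      set T : GL (Fin 2) (ZMod (5 ^ (m + 1 + 1))) :=
        ⟨!![D, 0; 0, 1], !![D ^ 3, 0; 0, 1],
          by
            ext i j
            fin_cases i <;> fin_cases j <;>
              simp [Matrix.mul_apply, Fin.sum_univ_two, hD13],
          by
            ext i j
            fin_cases i <;> fin_cases j <;>
              simp [Matrix.mul_apply, Fin.sum_univ_two, hD31]⟩ with hT
      have hTval : T.val = !![D, 0; 0, 1] := rfl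
      refine ⟨T * Matrix.SpecialLinearGroup.toGL S, fun _ => ⟨?_, ?_⟩⟩
      · -- `red (T S) = diag(δ, 1) · diag(δ⁻¹, 1) · a = a`
        apply Units.ext
        ext i j
        rw [Matrix.GeneralLinearGroup.map_apply, Units.val_mul, hTval, Matrix.SpecialLinearGroup.coe_GL_coe_matrix]
        have hs₁val : (s₁ : Matrix (Fin 2) (Fin 2) (ZMod (5 ^ (m + 1)))) =
            !![((u⁻¹ : (ZMod (5 ^ (m + 1)))ˣ) : ZMod (5 ^ (m + 1))), 0; 0, 1] *
              (a : Matrix (Fin 2) (Fin 2) (ZMod (5 ^ (m + 1)))) := rfl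
        have e00 := hSentry 0 j
        have e10 := hSentry 1 j
        rw [hs₁val] at e00 e10
        simp only [Matrix.mul_apply, Fin.sum_univ_two, Matrix.of_apply, Matrix.cons_val', Matrix.cons_val_zero,
          Matrix.cons_val_one, Matrix.empty_val', Matrix.cons_val_fin_one, Fin.isValue, zero_mul, add_zero,
          one_mul, zero_add] at e00 e10
        fin_cases i
        · simp only [Matrix.mul_apply, Fin.sum_univ_two, Matrix.of_apply, Matrix.cons_val', Matrix.cons_val_zero,
            Matrix.cons_val_one, Matrix.empty_val', Matrix.cons_val_fin_one, Fin.isValue, Fin.zero_eta, zero_mul,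
            add_zero, map_mul, hDred, e00, ← mul_assoc, Units.mul_inv, one_mul]
        · simp only [Matrix.mul_apply, Fin.sum_univ_two, Matrix.of_apply, Matrix.cons_val', Matrix.cons_val_zero,
            Matrix.cons_val_one, Matrix.empty_val', Matrix.cons_val_fin_one, Fin.isValue, Fin.mk_one, zero_mul,
            zero_add, one_mul, e10]
      · -- `det (T S) = D ∈ μ₄`
        rw [Units.val_mul, Matrix.det_mul, Matrix.SpecialLinearGroup.coe_GL_coe_matrix, S.prop, mul_one, hTval,
          Matrix.det_fin_two_of, mul_one, mul_zero, sub_zero, hD4]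
    choose L hL using hlift
    -- (3) the descended cocycle on `S^μ(ℤ/5^{m+1})`
    let fbar : GL (Fin 2) (ZMod (5 ^ (m + 1))) → Matrix (Fin 2) (Fin 2) (ZMod 5) := fun a => f (L a)
    have hfbar_tr : ∀ a : GL (Fin 2) (ZMod (5 ^ (m + 1))),
        Matrix.det (a : Matrix (Fin 2) (Fin 2) (ZMod (5 ^ (m + 1)))) ^ 4 = 1 → Matrix.trace (fbar a) = 0 :=
      fun a ha => htr _ (hL a ha).2
    have hfbar : ∀ a b : GL (Fin 2) (ZMod (5 ^ (m + 1))),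
        Matrix.det (a : Matrix (Fin 2) (Fin 2) (ZMod (5 ^ (m + 1)))) ^ 4 = 1 →
        Matrix.det (b : Matrix (Fin 2) (Fin 2) (ZMod (5 ^ (m + 1)))) ^ 4 = 1 →
          fbar (a * b) = fbar a + (ρ' a).val * fbar b * ((ρ' a)⁻¹).val := by
      intro a b ha hb
      have hab : Matrix.det ((a * b : GL (Fin 2) (ZMod (5 ^ (m + 1)))) : Matrix (Fin 2) (Fin 2) (ZMod (5 ^ (m + 1)))) ^ 4 = 1 := by
        rw [Units.val_mul, Matrix.det_mul, mul_pow, ha, hb, one_mul]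
      obtain ⟨hLab, hLabμ⟩ := hL (a * b) hab
      obtain ⟨hLa, hLaμ⟩ := hL a ha
      obtain ⟨hLb, hLbμ⟩ := hL b hb
      show f (L (a * b)) = f (L a) + (ρ' a).val * f (L b) * ((ρ' a)⁻¹).val
      rw [hfibre (L (a * b)) (L a * L b) hLabμ (hμ_mul _ _ hLaμ hLbμ) (by rw [hLab, map_mul, hLa, hLb]),
        hf _ _ hLaμ hLbμ, ← hρred (L a), hLa]
    obtain ⟨x, hx, hfx⟩ := ih fbar hfbar_tr hfbar
    refine ⟨x, hx, fun g hg => ?_⟩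
    obtain ⟨hLg, hLgμ⟩ := hL (red g) (hμ_red g hg)
    rw [hfibre g (L (red g)) hg hLgμ hLg.symm]
    show fbar (red g) = _
    rw [hfx (red g) (hμ_red g hg), hρred]

end smu

end Summit.BirchSwinnertonDyer.BirchSwinnertonDyer.Theorems.GL2F5AdjointBricks
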